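import Literature.Computability.Cryptography.TreeSigDistinguisherProb
import Literature.Computability.Cryptography.TreeSigExtraction
import Literature.Computability.Complexity.OracleLazyTables
import HarnessLib

/-!
# The authentication-tree scheme, VII: lazy sampling of the random table

Topic `Literature/Computability/Cryptography`; continues `TreeSigDistinguisherProb.lean` (the ideal PRF game of the
distinguisher as an average, over its coins, of a counting probability over the random table `H`). The one-time
forger of the security proof (Goldreich 2004, proof of Prop. 6.4.15 / 6.4.17) cannot hold a random function; it
samples the node blocks LAZILY from its own coins — "uniformly selected strings to every new point" (Goldreich 2001,
proof of Thm. 3.6.6, Claim 3.6.6.1, the lazy-sampling principle, in the tree as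
`Complexity/OracleLazyTables.lean`, `TableSpec.prob_run_tableOracle_eq`). This file performs that replacement for
the distinguisher `D` of `TreeSigDistinguisher.lean`, whose table queries are non-adaptive:

* `tspec n R` — how the queries address the table (`(n+1)`-bit queries are keys, answered by the `R`-bit value);
  `tableOracle_tspec`: its eager oracle IS `oracleOfTable`;
* `lazyAnswers s keys tbl` — the answers of the lazy rule along a LIST of (optional) keys from the supply `s` and the
  table `tbl` (one supply value consumed per round, a fresh key stored); `lazyTab n r s` — the table the lazy run of
  `D` on `⟨1ⁿ, r⟩` fetches (`lazyAux_DAlg`), a well-formed table (`goodTab_lazyTab`);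
* **`tableProb_forgeWith_eq_supplyProb`** — the counting probability over `H` of the forgery event of the emulated
  attack equals the counting probability, over supplies `s : Fin (fuelD n) → {0,1}^{R(n)}`, of the forgery event of
  the attack over the lazily sampled table; **`prfIdealProb_distinguisher_lazy`** — hence the ideal game of `D` is the
  average over `r` of the latter.

All statements proved; no named facts.

## References

* O. Goldreich, *Foundations of Cryptography I*, CUP 2001, proof of Thm. 3.6.6 (Claim 3.6.6.1: lazy sampling).
* O. Goldreich, *Foundations of Cryptography II*, CUP 2004, §6.4.2.2–6.4.2.3, proofs of Prop. 6.4.15 / 6.4.17 (the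
  reduction generates the one-time instances itself).
-/

namespace Literature.Computability.Cryptography

open _root_.Computability Complexity Complexity.Brick Polynomial Finset
open Complexity.OracleAlg Complexity.LazyTable

namespace TreeSig

/-! ### The table specification -/

/-- How the distinguisher's queries address a table `{0,1}^{n+1} → {0,1}^R`: an `(n+1)`-bit query is a key, answered by
the value as a string; other queries (never asked on labels of length `≤ n`) get `ε`. [Goldreich 2001, Thm. 3.6.6
(proof)] [folklore] -/
def tspec (n R : ℕ) : TableSpec (List.Vector Bool (n + 1)) (List.Vector Bool R) where
  key q := if h : q.length = n + 1 then some ⟨q, h⟩ else none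
  ans _ v := v.toList
  ans₀ _ := []

/-- **The eager oracle of `tspec` is `oracleOfTable`.** [folklore] -/
theorem tableOracle_tspec {n R : ℕ} (H : List.Vector Bool (n + 1) → List.Vector Bool R) : (tspec n R).tableOracle H = oracleOfTable H := by
  funext q
  simp only [TableSpec.tableOracle, tspec, oracleOfTable]
  split_ifs with h <;> rfl

/-! ### The lazy rule along a list of keys -/

section Lazy

variable {K V : Type} [DecidableEq K] [Inhabited V]

/-- The answers of the lazy rule along a list of optional keys: a keyless round answers `ε`, a stored key its value, a
fresh key the head of the supply (stored); one supply value is consumed per round. [Goldreich 2001, Thm. 3.6.6 (proof,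
Claim 3.6.6.1)] [folklore] -/
def lazyAnswers (toStr : V → List Bool) : List V → List (Option K) → List (K × V) → List (List Bool)
  | _, [], _ => []
  | s, none :: ks, tbl => [] :: lazyAnswers toStr s.tail ks tbl
  | s, some κ :: ks, tbl =>
    match assocFind κ tbl with
    | some w => toStr w :: lazyAnswers toStr s.tail ks tbl
    | none => toStr s.headI :: lazyAnswers toStr s.tail ks (tbl ++ [(κ, s.headI)])

/-- `lazyAnswers` has one answer per key. [folklore] -/
@[simp] theorem length_lazyAnswers (toStr : V → List Bool) : ∀ (s : List V) (ks : List (Option K)) (tbl : List (K × V)),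
    (lazyAnswers toStr s ks tbl).length = ks.length
  | _, [], _ => rfl
  | s, none :: ks, tbl => by rw [lazyAnswers, List.length_cons, length_lazyAnswers, List.length_cons]
  | s, some κ :: ks, tbl => by
    rw [lazyAnswers]
    cases assocFind κ tbl <;> simp [length_lazyAnswers]

/-- Every answer of `lazyAnswers` is `ε` or the string of a value. [folklore] -/
theorem mem_lazyAnswers (toStr : V → List Bool) : ∀ (s : List V) (ks : List (Option K)) (tbl : List (K × V)),
    ∀ a ∈ lazyAnswers toStr s ks tbl, a = [] ∨ ∃ v, a = toStr v
  | _, [], _, a, h => by simp [lazyAnswers] at h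
  | s, none :: ks, tbl, a, h => by
    rw [lazyAnswers, List.mem_cons] at h
    rcases h with rfl | h
    · exact Or.inl rfl
    · exact mem_lazyAnswers toStr _ _ _ a h
  | s, some κ :: ks, tbl, a, h => by
    rw [lazyAnswers] at h
    cases hf : assocFind κ tbl with
    | some w =>
      rw [hf] at h
      rcases List.mem_cons.1 h with rfl | h
      · exact Or.inr ⟨w, rfl⟩
      · exact mem_lazyAnswers toStr _ _ _ a h
    | none =>
      rw [hf] at h
      rcases List.mem_cons.1 h with rfl | h
      · exact Or.inr ⟨_, rfl⟩
      · exact mem_lazyAnswers toStr _ _ _ a h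

/-- One keyed round of the lazy rule. [folklore] -/
theorem lazyAnswers_some (toStr : V → List Bool) (s : List V) (κ : K) (ks : List (Option K)) (tbl : List (K × V)) :
    lazyAnswers toStr s (some κ :: ks) tbl =
      (match assocFind κ tbl with | some w => toStr w | none => toStr s.headI) ::
        lazyAnswers toStr s.tail ks (match assocFind κ tbl with | some _ => tbl | none => tbl ++ [(κ, s.headI)]) := by
  rw [lazyAnswers]
  cases assocFind κ tbl <;> rfl

/-- Keyed rounds are answered by strings of values. [folklore] -/
theorem getElem_lazyAnswers_of_isSome (toStr : V → List Bool) : ∀ (s : List V) (ks : List (Option K)) (tbl : List (K × V)) (j : ℕ)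
    (hj : j < (lazyAnswers toStr s ks tbl).length), (ks[j]'(by simpa using hj)).isSome → ∃ v, (lazyAnswers toStr s ks tbl)[j] = toStr v
  | _, [], _, j, hj, _ => by simp at hj
  | s, none :: ks, tbl, 0, _, h => by simp at h
  | s, none :: ks, tbl, j + 1, hj, h => by
    simp only [lazyAnswers, List.getElem_cons_succ]
    exact getElem_lazyAnswers_of_isSome toStr _ ks tbl j _ (by simpa using h)
  | s, some κ :: ks, tbl, 0, hj, _ => by
    rw [List.getElem_of_eq (lazyAnswers_some toStr s κ ks tbl) hj, List.getElem_cons_zero]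
    cases assocFind κ tbl with
    | some w => exact ⟨w, rfl⟩
    | none => exact ⟨_, rfl⟩
  | s, some κ :: ks, tbl, j + 1, hj, h => by
    rw [List.getElem_of_eq (lazyAnswers_some toStr s κ ks tbl) hj, List.getElem_cons_succ]
    have hj' : j < (lazyAnswers toStr s.tail ks (match assocFind κ tbl with | some _ => tbl | none => tbl ++ [(κ, s.headI)])).length := by
      rw [length_lazyAnswers]; rw [length_lazyAnswers] at hj; simpa using hj
    exact getElem_lazyAnswers_of_isSome toStr _ ks _ j hj' (by simpa using h)

end Lazy

/-! ### The lazy run of the distinguisher -/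

variable (P : Spec) (𝒜 : OracleAdversary (List Bool × List Bool))

/-- The optional key of the label fetched in round `j`. [folklore] -/
noncomputable def keyAt (n : ℕ) (ρ : List Bool) (j : ℕ) : Option (List.Vector Bool (n + 1)) := (tspec n (P.R.eval n)).key (code n (labAt n ρ j))

/-- The keys of the fetch phase on `⟨1ⁿ, r⟩`. [folklore] -/
noncomputable def keysD (n : ℕ) (r : List Bool) : List (Option (List.Vector Bool (n + 1))) :=
  (List.range (nFetch P 𝒜 n r)).map (keyAt P n (ρD P 𝒜 n r))

/-- **The lazily sampled table** the distinguisher fetches on `⟨1ⁿ, r⟩` from the supply `s`. [Goldreich 2001,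
Thm. 3.6.6 (proof, Claim 3.6.6.1); Goldreich 2004, proof of Prop. 6.4.15 (the reduction's own instances)] [folklore] -/
noncomputable def lazyTab (n : ℕ) (r : List Bool) (s : List (List.Vector Bool (P.R.eval n))) : List (List Bool) :=
  lazyAnswers List.Vector.toList s (keysD P 𝒜 n r) []

variable {P 𝒜}

/-- Labels fetched in the rounds the attack can use are keys. [folklore] -/
theorem keyAt_isSome {n : ℕ} (ρ : List Bool) {j : ℕ} (hj : j < 1 + 2 * n * TA P 𝒜 n) : (keyAt P n ρ j).isSome := by
  rw [keyAt, tspec]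
  simp only
  rw [dif_pos (length_code (length_labAt_le' (T := TA P 𝒜 n) ρ hj))]
  rfl

/-- The step of the distinguisher's algorithm. [folklore] -/
theorem DAlg_step (Pc c R : Polynomial ℕ) (x : List Bool) (as : List (List Bool)) :
    (DAlg P 𝒜 Pc c R).step x as = if as.length < (qD P 𝒜).eval x.length then Sum.inl (QD P 𝒜 (boolPair x (List.replicate as.length true)))
      else Sum.inr ((GD P 𝒜 Pc c R (boolPair x ((encodingList Bool).listBool.encode as))).headD false) := by
  rw [DAlg, postOut_step]
  by_cases h : as.length < (qD P 𝒜).eval x.length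
  · rw [ttFnAlgL_step_of_lt x h, if_pos h]
  · rw [ttFnAlgL_step_of_le x (not_lt.1 h), if_neg h]
    simp only [sndPow_succ_boolPair, sndPow_zero_boolPair]

/-- One query round of the lazy run of the distinguisher. [folklore] -/
theorem lazyAux_DAlg_succ (Pc c R : Polynomial ℕ) (n : ℕ) (r : List Bool) (m : ℕ) (as : List (List Bool))
    (tbl : List (List.Vector Bool (n + 1) × List.Vector Bool (P.R.eval n))) (s : List (List.Vector Bool (P.R.eval n))) (h : as.length < nFetch P 𝒜 n r) :
    (tspec n (P.R.eval n)).lazyAux (DAlg P 𝒜 Pc c R) (boolPair (unaryEncodeNat n) r) (m + 1) as tbl s =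
      match keyAt P n (ρD P 𝒜 n r) as.length with
      | none => (tspec n (P.R.eval n)).lazyAux (DAlg P 𝒜 Pc c R) (boolPair (unaryEncodeNat n) r) m (as ++ [[]]) tbl s.tail
      | some κ =>
        match assocFind κ tbl with
        | some w => (tspec n (P.R.eval n)).lazyAux (DAlg P 𝒜 Pc c R) (boolPair (unaryEncodeNat n) r) m (as ++ [w.toList]) tbl s.tail
        | none => (tspec n (P.R.eval n)).lazyAux (DAlg P 𝒜 Pc c R) (boolPair (unaryEncodeNat n) r) m (as ++ [s.headI.toList]) (tbl ++ [(κ, s.headI)]) s.tail := by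
  rw [TableSpec.lazyAux_succ, DAlg_step, if_pos (by rw [nFetch] at h; exact h), QD_apply]
  unfold keyAt
  dsimp only
  cases (tspec n (P.R.eval n)).key (code n (labAt n (ρD P 𝒜 n r) as.length)) with
  | none => rfl
  | some κ =>
    dsimp only
    cases assocFind κ tbl <;> rfl

/-- The last round of the lazy run of the distinguisher: the test. [folklore] -/
theorem lazyAux_DAlg_last (Pc c R : Polynomial ℕ) (n : ℕ) (r : List Bool) (m : ℕ) (as : List (List Bool))
    (tbl : List (List.Vector Bool (n + 1) × List.Vector Bool (P.R.eval n))) (s : List (List.Vector Bool (P.R.eval n))) (h : as.length = nFetch P 𝒜 n r) :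
    (tspec n (P.R.eval n)).lazyAux (DAlg P 𝒜 Pc c R) (boolPair (unaryEncodeNat n) r) (m + 1) as tbl s =
      some ((GD P 𝒜 Pc c R (boolPair (boolPair (unaryEncodeNat n) r) ((encodingList Bool).listBool.encode as))).headD false) := by
  rw [TableSpec.lazyAux_succ, DAlg_step, if_neg (by rw [nFetch] at h; omega)]

/-- **The lazy run of the distinguisher** (from round `j` with the transcript `as`, `|as| = j ≤ nFetch`): it ends with the
test on `as` followed by the lazy answers along the remaining keys. [Goldreich 2001, Thm. 3.6.6 (proof)] [folklore] -/
theorem lazyAux_DAlg_from (Pc c R : Polynomial ℕ) (n : ℕ) (r : List Bool) :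
    ∀ (k : ℕ) (as : List (List Bool)) (tbl : List (List.Vector Bool (n + 1) × List.Vector Bool (P.R.eval n)))
      (s : List (List.Vector Bool (P.R.eval n))) (m : ℕ), as.length + k = nFetch P 𝒜 n r → k < m →
      (tspec n (P.R.eval n)).lazyAux (DAlg P 𝒜 Pc c R) (boolPair (unaryEncodeNat n) r) m as tbl s =
        some ((GD P 𝒜 Pc c R (boolPair (boolPair (unaryEncodeNat n) r) ((encodingList Bool).listBool.encode
          (as ++ lazyAnswers List.Vector.toList s (((List.range (nFetch P 𝒜 n r)).drop as.length).map (keyAt P n (ρD P 𝒜 n r))) tbl)))).headD false)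
  | k, as, tbl, s, 0, _, hm => by omega
  | 0, as, tbl, s, m + 1, hk, _ => by
    rw [lazyAux_DAlg_last _ _ _ n r m as tbl s (by omega)]
    have hdrop : (List.range (nFetch P 𝒜 n r)).drop as.length = [] := List.drop_eq_nil_of_le (by simp; omega)
    rw [hdrop, List.map_nil, lazyAnswers, List.append_nil]
  | k + 1, as, tbl, s, m + 1, hk, hm => by
    rw [lazyAux_DAlg_succ _ _ _ n r m as tbl s (by omega)]
    have hdrop : (List.range (nFetch P 𝒜 n r)).drop as.length = as.length :: (List.range (nFetch P 𝒜 n r)).drop (as.length + 1) := by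
      rw [← List.getElem_cons_drop (by simp; omega), List.getElem_range]
    rw [hdrop, List.map_cons]
    cases keyAt P n (ρD P 𝒜 n r) as.length with
    | none =>
      dsimp only
      rw [lazyAux_DAlg_from Pc c R n r k (as ++ [[]]) tbl s.tail m (by simp; omega) (by omega), lazyAnswers]
      simp [List.append_assoc]
    | some κ =>
      dsimp only
      rw [lazyAnswers_some]
      cases assocFind κ tbl with
      | some w =>
        dsimp only
        rw [lazyAux_DAlg_from Pc c R n r k _ tbl s.tail m (by simp; omega) (by omega)]
        simp [List.append_assoc]
      | none =>
        dsimp only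
        rw [lazyAux_DAlg_from Pc c R n r k _ _ s.tail m (by simp; omega) (by omega)]
        simp [List.append_assoc]

/-- **The lazy run of the distinguisher from the start**: the test on the lazily sampled table. [folklore] -/
theorem lazyAux_DAlg (Pc c R : Polynomial ℕ) (n : ℕ) (r : List Bool) (s : List (List.Vector Bool (P.R.eval n))) {m : ℕ} (hm : nFetch P 𝒜 n r < m) :
    (tspec n (P.R.eval n)).lazyAux (DAlg P 𝒜 Pc c R) (boolPair (unaryEncodeNat n) r) m [] [] s =
      some ((GD P 𝒜 Pc c R (boolPair (boolPair (unaryEncodeNat n) r) ((encodingList Bool).listBool.encode (lazyTab P 𝒜 n r s)))).headD false) := by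
  rw [lazyAux_DAlg_from Pc c R n r (nFetch P 𝒜 n r) [] [] s m (by simp) hm]
  rfl

/-- **The lazily sampled table is well formed**: `nFetch ≥ 1 + 2n·TA` entries, and those the attack can use are
`R(n)`-bit blocks. [folklore] -/
theorem goodTab_lazyTab (n : ℕ) (r : List Bool) (s : List (List.Vector Bool (P.R.eval n))) : GoodTab P n (TA P 𝒜 n) (lazyTab P 𝒜 n r s) := by
  refine ⟨by rw [lazyTab, length_lazyAnswers, keysD, List.length_map, List.length_range]; exact qD_le_nFetch P 𝒜 n r, fun j hj hj' => ?_⟩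
  obtain ⟨v, hv⟩ := getElem_lazyAnswers_of_isSome List.Vector.toList s (keysD P 𝒜 n r) [] j hj' (by
    simp only [keysD, List.getElem_map, List.getElem_range]; exact keyAt_isSome _ hj)
  change P.pG.eval n ≤ ((lazyAnswers List.Vector.toList s (keysD P 𝒜 n r) [])[j]'hj').length
  rw [hv, List.Vector.toList_length]
  exact pG_le_R n

/-! ### The ideal game, lazily -/

/-- The counting probability, over uniformly random supplies `Fin m → V`, of an event. [folklore] -/
noncomputable def supplyProb {m R : ℕ} (f : (Fin m → List.Vector Bool R) → Prop) [DecidablePred f] : ℝ :=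
  ((univ.filter f).card : ℝ) / Fintype.card (Fin m → List.Vector Bool R)

/-- `supplyProb` only depends on the event. [folklore] -/
theorem supplyProb_congr {m R : ℕ} {f g : (Fin m → List.Vector Bool R) → Prop} [DecidablePred f] [DecidablePred g] (h : ∀ s, f s ↔ g s) :
    supplyProb f = supplyProb g := by
  unfold supplyProb
  rw [Finset.filter_congr fun s _ => h s]

open scoped Classical in
/-- **Lazy sampling of the table**: the counting probability over the random table `H` of the forgery event of the
emulated attack (nodes read off `H`) equals the counting probability over supplies of the forgery event of the attack
over the lazily sampled table. [Goldreich 2001, Thm. 3.6.6 (proof, Claim 3.6.6.1); Goldreich 2004, proof of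
Prop. 6.4.15] [folklore] -/
theorem tableProb_forgeWith_eq_supplyProb (hW : P.WF) {B : Bounds} (hB : B.OK P 𝒜) {n : ℕ} {r : List Bool} (hr : r.length = (cDPoly P 𝒜).eval n) :
    tableProb (fun H : List.Vector Bool (n + 1) → List.Vector Bool (P.R.eval n) =>
        ForgeWith P 𝒜 n (pkOf P n (blkO (oracleOfTable H) n [])) (OSig P (oracleOfTable H) n (ρD P 𝒜 n r)) (rA P 𝒜 n r)) =
      supplyProb (fun s : Fin ((fuelD P 𝒜).eval n) → List.Vector Bool (P.R.eval n) =>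
        ForgeWith P 𝒜 n (pk0 P n (lazyTab P 𝒜 n r (List.ofFn s))) (OTab P n (lazyTab P 𝒜 n r (List.ofFn s)) (ρD P 𝒜 n r)) (rA P 𝒜 n r)) := by
  classical
  have hρ : TA P 𝒜 n * n ≤ (ρD P 𝒜 n r).length := by rw [ρD, List.length_drop, hr, cDPoly_eval]; omega
  have hfuel : nFetch P 𝒜 n r < (fuelD P 𝒜).eval n := by rw [fuelD_eval P 𝒜 n hr]; exact Nat.lt_succ_self _
  -- both sides as acceptance probabilities of the distinguisher's algorithm
  have h1 : tableProb (fun H : List.Vector Bool (n + 1) → List.Vector Bool (P.R.eval n) =>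
      ForgeWith P 𝒜 n (pkOf P n (blkO (oracleOfTable H) n [])) (OSig P (oracleOfTable H) n (ρD P 𝒜 n r)) (rA P 𝒜 n r)) =
      tableProb (fun H : List.Vector Bool (n + 1) → List.Vector Bool (P.R.eval n) =>
        (DAlg P 𝒜 B.PcOf (B.cOf P 𝒜) (Bounds.ROf P 𝒜)).run ((tspec n (P.R.eval n)).tableOracle H) ((fuelD P 𝒜).eval n) (boolPair (unaryEncodeNat n) r) =
          some true) := by
    refine tableProb_congr fun H => ?_
    rw [tableOracle_tspec, show DAlg P 𝒜 B.PcOf (B.cOf P 𝒜) (Bounds.ROf P 𝒜) = (distinguisher P 𝒜 B.PcOf (B.cOf P 𝒜) (Bounds.ROf P 𝒜)).alg from rfl,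
      run_distinguisher hW hB (blockOracle_table H) hr]
    simp only [Option.some.injEq, decide_eq_true_eq]
  have h2 : supplyProb (fun s : Fin ((fuelD P 𝒜).eval n) → List.Vector Bool (P.R.eval n) =>
      ForgeWith P 𝒜 n (pk0 P n (lazyTab P 𝒜 n r (List.ofFn s))) (OTab P n (lazyTab P 𝒜 n r (List.ofFn s)) (ρD P 𝒜 n r)) (rA P 𝒜 n r)) =
      supplyProb (fun s : Fin ((fuelD P 𝒜).eval n) → List.Vector Bool (P.R.eval n) =>
        (tspec n (P.R.eval n)).lazyAux (DAlg P 𝒜 B.PcOf (B.cOf P 𝒜) (Bounds.ROf P 𝒜)) (boolPair (unaryEncodeNat n) r) ((fuelD P 𝒜).eval n) [] []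
          (List.ofFn s) = some true) := by
    refine supplyProb_congr fun s => ?_
    rw [lazyAux_DAlg _ _ _ n r _ hfuel, ← wOf, GD_eq hW hB (goodTab_lazyTab n r _) hρ]
    simp only [List.headD_cons, Option.some.injEq, decide_eq_true_eq]
  rw [h1, h2, tableProb, supplyProb]
  exact (tspec n (P.R.eval n)).prob_run_tableOracle_eq (DAlg P 𝒜 B.PcOf (B.cOf P 𝒜) (Bounds.ROf P 𝒜)) (boolPair (unaryEncodeNat n) r) _ true

open scoped Classical in
/-- **The ideal PRF game of the distinguisher, lazily**: the average over its coins of the counting probability over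
supplies of the forgery event of the emulated attack over the lazily sampled table.
[Goldreich 2004, proofs of Prop. 6.4.15 / 6.4.17 with Goldreich 2001, Claim 3.6.6.1] [cite: Goldreich2004, Prop. 6.4.17] -/
theorem prfIdealProb_distinguisher_lazy (hW : P.WF) {B : Bounds} (hB : B.OK P 𝒜) (n : ℕ) :
    prfIdealProb (fun m => m + 1) (fun m => P.R.eval m) (distinguisher P 𝒜 B.PcOf (B.cOf P 𝒜) (Bounds.ROf P 𝒜)) n =
      uniformAvg ((cDPoly P 𝒜).eval n) fun r => supplyProb (fun s : Fin ((fuelD P 𝒜).eval n) → List.Vector Bool (P.R.eval n) =>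
        ForgeWith P 𝒜 n (pk0 P n (lazyTab P 𝒜 n r (List.ofFn s))) (OTab P n (lazyTab P 𝒜 n r (List.ofFn s)) (ρD P 𝒜 n r)) (rA P 𝒜 n r)) := by
  rw [prfIdealProb_distinguisher hW hB n]
  exact SigOWF.uniformAvg_congr' fun r hr => tableProb_forgeWith_eq_supplyProb hW hB hr

/-! ### The lazily sampled table in closed form: first occurrences -/

section FirstOcc

variable {K V : Type} [DecidableEq K] [Inhabited V]

/-- The index of the first `some κ` in a list of optional keys (the length if there is none). [folklore] -/
def fIdx (κ : K) : List (Option K) → ℕ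
  | [] => 0
  | k :: ks => if k = some κ then 0 else fIdx κ ks + 1

/-- The first occurrence is at most any occurrence. [folklore] -/
theorem fIdx_le_of_getElem (κ : K) : ∀ (ks : List (Option K)) (j : ℕ) (hj : j < ks.length), ks[j] = some κ → fIdx κ ks ≤ j
  | [], j, hj, _ => by simp at hj
  | k :: ks, 0, _, h => by simp only [List.getElem_cons_zero] at h; simp [fIdx, h]
  | k :: ks, j + 1, hj, h => by
    rw [fIdx]
    split_ifs
    · exact Nat.zero_le _
    · exact Nat.succ_le_succ (fIdx_le_of_getElem κ ks j (by simpa using hj) (by simpa using h))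

/-- `some κ` is among the first `p` keys iff it occurs and its first occurrence is `< p`. [folklore] -/
theorem mem_take_iff_fIdx (κ : K) : ∀ (ks : List (Option K)) (p : ℕ), some κ ∈ ks.take p ↔ some κ ∈ ks ∧ fIdx κ ks < p
  | [], p => by simp
  | k :: ks, 0 => by simp
  | k :: ks, p + 1 => by
    rw [List.take_succ_cons, List.mem_cons, List.mem_cons, fIdx, mem_take_iff_fIdx κ ks p]
    by_cases h : k = some κ
    · subst h; simp
    · rw [if_neg h]
      constructor
      · rintro (h' | ⟨h1, h2⟩)
        · exact absurd h'.symm h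
        · exact ⟨Or.inr h1, by omega⟩
      · rintro ⟨h' | h', hlt⟩
        · exact absurd h'.symm h
        · exact Or.inr ⟨h', by omega⟩

/-- A key occurring at `j` whose first occurrence is not before `p ≤ j`… in particular, if `ks[p] = some κ` and
`some κ ∉ ks.take p` then `fIdx κ ks = p`. [folklore] -/
theorem fIdx_eq_of_getElem_of_not_mem (κ : K) (ks : List (Option K)) (p : ℕ) (hp : p < ks.length) (h : ks[p] = some κ)
    (hn : some κ ∉ ks.take p) : fIdx κ ks = p := by
  have h1 := fIdx_le_of_getElem κ ks p hp h
  have hmem : some κ ∈ ks := h ▸ List.getElem_mem hp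
  have h2 : ¬ fIdx κ ks < p := fun hlt => hn ((mem_take_iff_fIdx κ ks p).2 ⟨hmem, hlt⟩)
  omega

/-- The head of a dropped list is the default-indexed element. [folklore] -/
theorem headI_drop (S : List V) : ∀ p : ℕ, (S.drop p).headI = S.getI p := by
  induction S with
  | nil => intro p; simp
  | cons a S ih =>
    intro p
    cases p with
    | zero => simp
    | succ p => rw [List.drop_succ_cons, ih]; simp

/-- The table invariant of the lazy rule after `p` rounds of the keys `ks` from the supply `S`: a key is stored iff it
is among the first `p` keys, with the value consumed at its first occurrence. [Goldreich 2001, Thm. 3.6.6 (proof,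
Claim 3.6.6.1)] [folklore] -/
def TabInv (S : List V) (ks : List (Option K)) (p : ℕ) (tbl : List (K × V)) : Prop :=
  ∀ κ, assocFind κ tbl = if some κ ∈ ks.take p then some (S.getI (fIdx κ ks)) else none

/-- The invariant holds initially. [folklore] -/
theorem tabInv_zero (S : List V) (ks : List (Option K)) : TabInv S ks 0 ([] : List (K × V)) := fun κ => by simp

/-- **The lazy answers in closed form**: the answer of round `p + j` is `ε` on a keyless round and otherwise the string
of the supply value at the FIRST occurrence of its key. [Goldreich 2001, Thm. 3.6.6 (proof, Claim 3.6.6.1)] [folklore] -/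
theorem getElem_lazyAnswers (toStr : V → List Bool) (S : List V) (ks : List (Option K)) :
    ∀ (j p : ℕ) (tbl : List (K × V)), TabInv S ks p tbl → ∀ (hj : p + j < ks.length)
      (hj' : j < (lazyAnswers toStr (S.drop p) (ks.drop p) tbl).length),
      (lazyAnswers toStr (S.drop p) (ks.drop p) tbl)[j] =
        match ks[p + j] with
        | none => []
        | some κ => toStr (S.getI (fIdx κ ks))
  | 0, p, tbl, hinv, hj, hj' => by
    have hdrop : ks.drop p = ks[p] :: ks.drop (p + 1) := (List.getElem_cons_drop (by omega)).symm
    cases hk : ks[p] with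
    | none =>
      have : lazyAnswers toStr (S.drop p) (ks.drop p) tbl = [] :: lazyAnswers toStr (S.drop p).tail (ks.drop (p + 1)) tbl := by
        rw [hdrop, hk, lazyAnswers]
      rw [List.getElem_of_eq this hj', List.getElem_cons_zero]
    | some κ =>
      have := lazyAnswers_some toStr (S.drop p) κ (ks.drop (p + 1)) tbl
      rw [← hk, ← hdrop] at this
      rw [List.getElem_of_eq this hj', List.getElem_cons_zero]
      dsimp only
      rw [hinv κ]
      by_cases hmem : some κ ∈ ks.take p
      · rw [if_pos hmem]
      · rw [if_neg hmem]
        dsimp only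
        rw [headI_drop, fIdx_eq_of_getElem_of_not_mem κ ks p (by omega) hk hmem]
  | j + 1, p, tbl, hinv, hj, hj' => by
    have hdrop : ks.drop p = ks[p] :: ks.drop (p + 1) := (List.getElem_cons_drop (by omega)).symm
    have hS : (S.drop p).tail = S.drop (p + 1) := by rw [List.tail_drop]
    have htake : ks.take (p + 1) = ks.take p ++ [ks[p]] := List.take_succ_eq_append_getElem (by omega)
    have hidx : ∀ (h1 : p + 1 + j < ks.length), ks[p + 1 + j]'h1 = ks[p + (j + 1)]'hj := by intro h1; congr 1; omega
    -- the continuation: from the invariant of the next table and the unfolding of round `p`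
    have cont : ∀ (a : List Bool) (tbl' : List (K × V)), TabInv S ks (p + 1) tbl' →
        lazyAnswers toStr (S.drop p) (ks.drop p) tbl = a :: lazyAnswers toStr (S.drop (p + 1)) (ks.drop (p + 1)) tbl' →
        (lazyAnswers toStr (S.drop p) (ks.drop p) tbl)[j + 1] = match ks[p + (j + 1)] with
          | none => []
          | some κ => toStr (S.getI (fIdx κ ks)) := by
      intro a tbl' hinv' heq
      have hlen : j < (lazyAnswers toStr (S.drop (p + 1)) (ks.drop (p + 1)) tbl').length := by rw [length_lazyAnswers, List.length_drop]; omega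
      have IH := getElem_lazyAnswers toStr S ks j (p + 1) tbl' hinv' (by omega) hlen
      rw [hidx] at IH
      rw [List.getElem_of_eq heq hj', List.getElem_cons_succ, IH]
    cases hk : ks[p] with
    | none =>
      refine cont [] tbl (fun κ' => ?_) (by rw [hdrop, hk, lazyAnswers, hS])
      rw [hinv κ', htake, hk]
      simp
    | some κ =>
      cases hf : assocFind κ tbl with
      | some w =>
        have hmem : some κ ∈ ks.take p := by
          by_contra hn; rw [hinv κ, if_neg hn] at hf; cases hf
        refine cont (toStr w) tbl (fun κ' => ?_) (by rw [hdrop, hk, lazyAnswers, hf, hS])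
        rw [hinv κ', htake, hk]
        by_cases h' : some κ' ∈ ks.take p
        · rw [if_pos h', if_pos (List.mem_append_left _ h')]
        · have hne : κ ≠ κ' := by rintro rfl; exact h' hmem
          rw [if_neg h', if_neg]
          rw [List.mem_append, List.mem_singleton, not_or]
          exact ⟨h', fun h => hne (Option.some_injective _ h).symm⟩
      | none =>
        have hnmem : some κ ∉ ks.take p := by
          intro hm; rw [hinv κ, if_pos hm] at hf; cases hf
        refine cont (toStr (S.drop p).headI) (tbl ++ [(κ, (S.drop p).headI)]) (fun κ' => ?_) (by rw [hdrop, hk, lazyAnswers, hf, hS])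
        rw [assocFind_append_singleton, hinv κ', htake, hk]
        by_cases h' : some κ' ∈ ks.take p
        · rw [if_pos h', if_pos (List.mem_append_left _ h')]
        · rw [if_neg h']
          dsimp only
          by_cases hκ : κ = κ'
          · subst hκ
            rw [if_pos rfl, if_pos (List.mem_append_right _ (List.mem_singleton_self _)), headI_drop,
              fIdx_eq_of_getElem_of_not_mem κ ks p (by omega) hk hnmem]
          · rw [if_neg hκ, if_neg]
            rw [List.mem_append, List.mem_singleton, not_or]
            exact ⟨h', fun h => hκ (Option.some_injective _ h).symm⟩

/-- **The lazy answers from the start, in closed form.** [Goldreich 2001, Thm. 3.6.6 (proof)] [folklore] -/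
theorem getElem_lazyAnswers_nil (toStr : V → List Bool) (S : List V) (ks : List (Option K)) (j : ℕ)
    (hj : j < (lazyAnswers toStr S ks ([] : List (K × V))).length) :
    (lazyAnswers toStr S ks ([] : List (K × V)))[j] = match ks[j]'(by simpa using hj) with
      | none => []
      | some κ => toStr (S.getI (fIdx κ ks)) := by
  have h := getElem_lazyAnswers toStr S ks j 0 [] (tabInv_zero S ks) (by simpa using hj) (by simpa using hj)
  simp only [List.drop_zero, Nat.zero_add] at h
  exact h

end FirstOcc

/-! ### The block assignment of the lazily sampled table -/

variable (P 𝒜)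

/-- **The block assignment of the lazy table**: the block of the label `L` is `ε` if its code is not a key, else the
supply value at the first round fetching (a label with) the same key. [Goldreich 2001, Thm. 3.6.6 (proof)] [folklore] -/
noncomputable def TabL (n : ℕ) (r : List Bool) (s : List (List.Vector Bool (P.R.eval n))) (L : List Bool) : List Bool :=
  match (tspec n (P.R.eval n)).key (code n L) with
  | none => []
  | some κ => (s.getI (fIdx κ (keysD P 𝒜 n r))).toList

variable {P 𝒜}

/-- **The lazy table reads the block assignment at the fetched labels.** [folklore] -/
theorem getElem_lazyTab {n : ℕ} (r : List Bool) (s : List (List.Vector Bool (P.R.eval n))) (j : ℕ) (hj : j < (lazyTab P 𝒜 n r s).length) :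
    (lazyTab P 𝒜 n r s)[j] = TabL P 𝒜 n r s (labAt n (ρD P 𝒜 n r) j) := by
  change (lazyAnswers List.Vector.toList s (keysD P 𝒜 n r) ([] : List (List.Vector Bool (n + 1) × List.Vector Bool (P.R.eval n))))[j]'hj = _
  rw [getElem_lazyAnswers_nil List.Vector.toList s (keysD P 𝒜 n r) j hj, TabL]
  have hk : (keysD P 𝒜 n r)[j]'(by simpa [lazyTab] using hj) = (tspec n (P.R.eval n)).key (code n (labAt n (ρD P 𝒜 n r) j)) := by
    simp only [keysD, List.getElem_map, List.getElem_range, keyAt]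
  rw [hk]
  cases (tspec n (P.R.eval n)).key (code n (labAt n (ρD P 𝒜 n r) j)) with
  | none => rfl
  | some κ => dsimp only

/-- **The per-path tables of the lazy table are the block assignment** on the root and along the leaf, below the
budget. [folklore] -/
theorem tabFun_lazyTab {n : ℕ} {r : List Bool} (hρ : TA P 𝒜 n * n ≤ (ρD P 𝒜 n r).length) (s : List (List.Vector Bool (P.R.eval n)))
    {i : ℕ} (hi : i < TA P 𝒜 n) {L : List Bool} (hL : L = [] ∨ L ∈ pathLabels (Yao.blk n i (ρD P 𝒜 n r))) :
    tabFun n i (lazyTab P 𝒜 n r s) L = TabL P 𝒜 n r s L := by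
  have hσ : (i + 1) * n ≤ (ρD P 𝒜 n r).length := le_trans (Nat.mul_le_mul_right n hi) hρ
  have hp : pos n i L < 1 + 2 * n * TA P 𝒜 n := pos_lt_of_mem n i hi _ (Yao.length_blk_of_le hσ) hL
  have hp' : pos n i L < (lazyTab P 𝒜 n r s).length := by
    rw [lazyTab, length_lazyAnswers, keysD, List.length_map, List.length_range]; exact hp.trans_le (qD_le_nFetch P 𝒜 n r)
  rw [tabFun, List.getD_eq_getElem _ _ hp', getElem_lazyTab]
  congr 1
  rcases hL with rfl | hL
  · simp [pos]
  · obtain ⟨t, ht, rfl⟩ := List.getElem_of_mem hL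
    have htn : t < 2 * n := by rw [length_pathLabels, Yao.length_blk_of_le hσ] at ht; exact ht
    rw [pos_getElem_pathLabels n i _ t ht, labAt_pos n i _ hσ t htn]

/-- The table signer over the lazy table IS the signer over its block assignment, below the budget. [folklore] -/
theorem OTab_lazyTab {n : ℕ} {r : List Bool} (hρ : TA P 𝒜 n * n ≤ (ρD P 𝒜 n r).length) (s : List (List.Vector Bool (P.R.eval n)))
    {i : ℕ} (hi : i < TA P 𝒜 n) (α : List Bool) :
    OTab P n (lazyTab P 𝒜 n r s) (ρD P 𝒜 n r) i α = OFun P n (TabL P 𝒜 n r s) (ρD P 𝒜 n r) i α :=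
  sigG_congr n (tabFun_lazyTab hρ s hi (Or.inl rfl)) (fun _ hL => tabFun_lazyTab hρ s hi (Or.inr hL)) α

/-- The root key over the lazy table. [folklore] -/
theorem pk0_lazyTab {n : ℕ} (r : List Bool) (s : List (List.Vector Bool (P.R.eval n))) :
    pk0 P n (lazyTab P 𝒜 n r s) = pkOf P n (TabL P 𝒜 n r s []) := by
  have h0 : 0 < (lazyTab P 𝒜 n r s).length := by
    rw [lazyTab, length_lazyAnswers, keysD, List.length_map, List.length_range]; exact lt_of_lt_of_le (by omega) (qD_le_nFetch P 𝒜 n r)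
  rw [pk0, List.getD_eq_getElem _ _ h0, getElem_lazyTab, labAt_zero]

/-- **The forgery event over the lazy table is the forgery event over its block assignment.** [folklore] -/
theorem forgeWith_lazyTab_iff {n : ℕ} {r : List Bool} (hρ : TA P 𝒜 n * n ≤ (ρD P 𝒜 n r).length) (s : List (List.Vector Bool (P.R.eval n))) :
    ForgeWith P 𝒜 n (pk0 P n (lazyTab P 𝒜 n r s)) (OTab P n (lazyTab P 𝒜 n r s) (ρD P 𝒜 n r)) (rA P 𝒜 n r) ↔
      ForgeWith P 𝒜 n (pkOf P n (TabL P 𝒜 n r s [])) (OFun P n (TabL P 𝒜 n r s) (ρD P 𝒜 n r)) (rA P 𝒜 n r) := by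
  rw [pk0_lazyTab, forgeWith_congr _ (fun i hi α => OTab_lazyTab hρ s hi α)]

open scoped Classical in
/-- **The ideal PRF game of the distinguisher over the lazy block assignment**: the average over its coins of the
counting probability over supplies of the forgery event of the attack against the signer over `TabL`.
[Goldreich 2004, proofs of Prop. 6.4.15 / 6.4.17 with Goldreich 2001, Claim 3.6.6.1] [cite: Goldreich2004, Prop. 6.4.17] -/
theorem prfIdealProb_distinguisher_TabL (hW : P.WF) {B : Bounds} (hB : B.OK P 𝒜) (n : ℕ) :
    prfIdealProb (fun m => m + 1) (fun m => P.R.eval m) (distinguisher P 𝒜 B.PcOf (B.cOf P 𝒜) (Bounds.ROf P 𝒜)) n =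
      uniformAvg ((cDPoly P 𝒜).eval n) fun r => supplyProb (fun s : Fin ((fuelD P 𝒜).eval n) → List.Vector Bool (P.R.eval n) =>
        ForgeWith P 𝒜 n (pkOf P n (TabL P 𝒜 n r (List.ofFn s) [])) (OFun P n (TabL P 𝒜 n r (List.ofFn s)) (ρD P 𝒜 n r)) (rA P 𝒜 n r)) := by
  rw [prfIdealProb_distinguisher_lazy hW hB n]
  refine SigOWF.uniformAvg_congr' fun r hr => supplyProb_congr fun s => ?_
  have hρ : TA P 𝒜 n * n ≤ (ρD P 𝒜 n r).length := by rw [ρD, List.length_drop, hr, cDPoly_eval]; omega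
  exact forgeWith_lazyTab_iff hρ _

end TreeSig

end Literature.Computability.Cryptography
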